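import Summits.Ventures.HodgeRepro2.T5SU11ResolventL2SchurWeighted

/-!
# The weighted `L¹` bound of the resolvent for every `λ > 1`: the weight `φ_{λ′}`, `1 < λ′ < λ`

Row 546 bounds the resolvent on `L¹(sinh 2t dt)` for `λ > 2` (row sums `1/μ`). For every `λ > 1` the spherical weight
`φ_{λ′}`, `1 < λ′ < λ`, does the same: row 520's columns `∫_t |K_λ(t, s)| φ_{λ′}(t) sinh 2t dt = φ_{λ′}(s)/(μ − μ′)`
(`μ − μ′ = λ(λ − 2) − λ′(λ′ − 2) > 0`) and Fubini give, for a source `g` of the class (rate `ε > 2 − λ`) with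
**`|g| φ_{λ′} sinh 2s ∈ L¹(0, ∞)`**,

* `integrable_prod_kernel_abs_weighted` — `|K_λ(t, s)| |g(s)| sinh 2s · φ_{λ′}(t) sinh 2t` is integrable on `(0, ∞)²`;
* `abs_greenSolI_le_integral_abs` — the pointwise bound `|G^I_λ g(t)| ≤ ∫_s |K_λ(t, s)| |g(s)| sinh 2s ds`;
* `integrableOn_greenSolI_mul_sph_mul_sinh` — **`G^I_λ g · φ_{λ′} sinh 2t` is integrable on `(0, ∞)`**: the resolvent
  preserves `L¹(φ_{λ′} sinh 2t dt) ∩ class` for every `λ > 1`;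
* `integral_abs_greenSolI_mul_sph_mul_sinh_le` — **`∫ |G^I_λ g| φ_{λ′} sinh 2t ≤ (∫ |g| φ_{λ′} sinh 2s)/(μ − μ′)`** — the
  operator norm of `(L − μ)⁻¹` on `L¹(φ_{λ′} sinh 2t dt)` is at most `1/(μ − μ′)`, the same constant as the weighted
  sup-norm bound of row 550 (the two Schur constants coincide because the kernel is symmetric).

Nothing is claimed about (N).

Blind lane: Mathlib + the HodgeRepro2 prefix only; no sorry; axioms ⊆ {propext, Classical.choice,
Quot.sound}.
-/

namespace Summit.Ventures.HodgeRepro2.T5SU11ResolventL1Weighted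

open Filter Topology MeasureTheory
open Set (Ioi Ioc)
open T5SU11Cartan T5SU11SphericalFunction T5SU11SphericalDecay T5SU11RadialGreenKernel
  T5SU11RadialGreenImproper T5SU11RadialGreenImproperDecaySource T5SU11RadialGreenImproperStable
  T5SU11ResolventKernelComposition T5SU11ResolventTransformClass T5SU11RadialGreenPositivity
  T5SU11SphericalContinuous T5SU11SphericalBounds T5SU11ResolventL2SchurWeighted

section measure

variable [MeasurableSpace Circle] [BorelSpace Circle]

variable {lam lam' : ℝ} (hlam : 1 < lam) (h1 : 1 < lam') (h2 : lam' < lam)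
  {g : ℝ → ℝ} (hg : ContinuousOn g (Ioi 0))
  {M : ℝ} (hM : ∀ s ∈ Ioc (0 : ℝ) 1, |g s| ≤ M) (hM0 : 0 ≤ M)
  {ε C s₀ : ℝ} (hε : 2 - lam < ε) (hC : ∀ s, s₀ ≤ s → |g s| ≤ C * Real.exp (-ε * s))
  (hg1 : IntegrableOn (fun s => |g s| * sph lam' (hyp s) * Real.sinh (2 * s)) (Ioi 0))

include hlam h1 h2 hg hg1 in
/-- **The weighted product integrand `|K_λ(t, s)| |g(s)| sinh 2s · φ_{λ′}(t) sinh 2t` is integrable on `(0, ∞)²`** for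
every continuous source with `|g| φ_{λ′} sinh 2s ∈ L¹(0, ∞)`. -/
theorem integrable_prod_kernel_abs_weighted :
    Integrable (Function.uncurry fun t s => |sphGreenKernel lam t s| * (|g s| * Real.sinh (2 * s))
        * (sph lam' (hyp t) * Real.sinh (2 * t)))
      ((volume.restrict (Ioi 0)).prod (volume.restrict (Ioi 0))) := by
  have hμ : 0 < lam * (lam - 2) - lam' * (lam' - 2) := by nlinarith
  have hχ : ContinuousOn (sphDecay lam) (Ioi 0) :=
    fun _ hr => (hasDerivAt_sphDecay hlam hr).continuousAt.continuousWithinAt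
  -- measurability: the integrand is continuous on the open quadrant
  have hmeas : AEStronglyMeasurable (Function.uncurry fun t s => |sphGreenKernel lam t s|
      * (|g s| * Real.sinh (2 * s)) * (sph lam' (hyp t) * Real.sinh (2 * t)))
      ((volume.restrict (Ioi 0)).prod (volume.restrict (Ioi 0))) := by
    rw [Measure.prod_restrict]
    refine ContinuousOn.aestronglyMeasurable ?_ (measurableSet_Ioi.prod measurableSet_Ioi)
    have hK : ContinuousOn (fun p : ℝ × ℝ => sphGreenKernel lam p.1 p.2) (Ioi 0 ×ˢ Ioi 0) := by
      simp only [sphGreenKernel, greenKernel]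
      apply ContinuousOn.neg
      apply ContinuousOn.mul
      · exact ((continuous_sph_hyp lam).comp (continuous_fst.min continuous_snd)).continuousOn
      · exact hχ.comp (continuous_fst.max continuous_snd).continuousOn
          (fun p hp => Set.mem_Ioi.mpr (lt_of_lt_of_le (Set.mem_Ioi.mp hp.1) (le_max_left _ _)))
    have hg' : ContinuousOn (fun p : ℝ × ℝ => g p.2) (Ioi 0 ×ˢ Ioi 0) :=
      hg.comp continuous_snd.continuousOn (fun p hp => hp.2)
    have hφt : ContinuousOn (fun p : ℝ × ℝ => sph lam' (hyp p.1)) (Ioi 0 ×ˢ Ioi 0) :=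
      ((continuous_sph_hyp lam').comp continuous_fst).continuousOn
    exact (hK.abs.mul (hg'.abs.mul
      (Real.continuous_sinh.comp (continuous_const.mul continuous_snd)).continuousOn)).mul
      (hφt.mul (Real.continuous_sinh.comp (continuous_const.mul continuous_fst)).continuousOn)
  rw [integrable_prod_iff' hmeas]
  refine ⟨?_, ?_⟩
  · -- for every `s > 0`, the weighted column `t ↦ |K_λ(t, s)| φ_{λ′}(t) sinh 2t · |g s| sinh 2s` is integrable
    refine (ae_restrict_iff' measurableSet_Ioi).mpr (Eventually.of_forall fun s hs => ?_)
    have hs0 : 0 < s := hs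
    have h : IntegrableOn (fun t => |sphGreenKernel lam t s * sph lam' (hyp t) * Real.sinh (2 * t)|
        * (|g s| * Real.sinh (2 * s))) (Ioi 0) :=
      (integrableOn_kernel_mul_sph hlam h1 h2 hs0).abs.mul_const (|g s| * Real.sinh (2 * s))
    refine h.congr_fun (fun t ht => ?_) measurableSet_Ioi
    have ht0 : 0 < t := ht
    simp only [Function.uncurry_apply_pair]
    rw [abs_mul, abs_mul, abs_of_pos (sph_hyp_pos lam' t),
      abs_of_nonneg (Real.sinh_nonneg_iff.mpr (by linarith : (0 : ℝ) ≤ 2 * t))]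
    ring
  · -- the outer function `s ↦ ∫_t ‖F(t, s)‖ dt = |g s| φ_{λ′}(s) sinh 2s/(μ − μ′)` is integrable
    have hI := hg1.mul_const (1 / (lam * (lam - 2) - lam' * (lam' - 2)))
    refine hI.congr ?_
    refine (ae_restrict_iff' measurableSet_Ioi).mpr (Eventually.of_forall fun s hs => ?_)
    have hs0 : 0 < s := hs
    have hsinh : 0 ≤ Real.sinh (2 * s) := Real.sinh_nonneg_iff.mpr (by linarith)
    simp only
    have e : ∫ t in Ioi 0, ‖Function.uncurry (fun t s => |sphGreenKernel lam t s| * (|g s| * Real.sinh (2 * s))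
        * (sph lam' (hyp t) * Real.sinh (2 * t))) (t, s)‖
        = ∫ t in Ioi 0, |sphGreenKernel lam t s * sph lam' (hyp t) * Real.sinh (2 * t)|
          * (|g s| * Real.sinh (2 * s)) := by
      apply setIntegral_congr_fun measurableSet_Ioi
      intro t ht
      have ht0 : 0 < t := ht
      have hsinh_t : 0 ≤ Real.sinh (2 * t) := Real.sinh_nonneg_iff.mpr (by linarith)
      have hF0 : 0 ≤ |sphGreenKernel lam t s| * (|g s| * Real.sinh (2 * s)) * (sph lam' (hyp t) * Real.sinh (2 * t)) :=
        mul_nonneg (mul_nonneg (abs_nonneg _) (mul_nonneg (abs_nonneg _) hsinh))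
          (mul_nonneg (sph_hyp_pos lam' t).le hsinh_t)
      simp only [Function.uncurry_apply_pair, Real.norm_eq_abs]
      rw [abs_of_nonneg hF0, abs_mul, abs_mul, abs_of_pos (sph_hyp_pos lam' t), abs_of_nonneg hsinh_t]
      ring
    rw [e, MeasureTheory.integral_mul_const, integral_abs_kernel_mul_sph_fst hlam h1 h2 hs0]
    ring

include hlam hg hM hM0 hε hC in
/-- The pointwise bound `|G^I_λ g(t)| ≤ ∫_{(0,∞)} |K_λ(t, s)| |g(s)| sinh 2s ds` for every `t > 0` and every source of the
class (`λ > 1`). -/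
theorem abs_greenSolI_le_integral_abs {t : ℝ} (ht : 0 < t) :
    |greenSolI (fun t => sph lam (hyp t)) (sphDecay lam) g t|
      ≤ ∫ s in Ioi 0, |sphGreenKernel lam t s| * (|g s| * Real.sinh (2 * s)) := by
  have hB := integrableOn_sph_mul_mul_sinh_Ioc hg hM hM0 lam
  have hA := integrableOn_sphDecay_mul_mul_sinh hlam hg hM hM0 hε hC
  rw [greenSolI_eq_integral_kernel hB hA ht]
  change |∫ s in Ioi 0, sphGreenKernel lam t s * g s * Real.sinh (2 * s)| ≤ _
  calc |∫ s in Ioi 0, sphGreenKernel lam t s * g s * Real.sinh (2 * s)|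
      ≤ ∫ s in Ioi 0, |sphGreenKernel lam t s * g s * Real.sinh (2 * s)| := by
        have := norm_integral_le_integral_norm (μ := volume.restrict (Ioi 0))
          (fun s => sphGreenKernel lam t s * g s * Real.sinh (2 * s))
        simpa only [Real.norm_eq_abs] using this
    _ = ∫ s in Ioi 0, |sphGreenKernel lam t s| * (|g s| * Real.sinh (2 * s)) := by
        apply setIntegral_congr_fun measurableSet_Ioi
        intro s hs
        have hs0 : 0 < s := hs
        simp only
        rw [abs_mul, abs_mul, abs_of_nonneg (Real.sinh_nonneg_iff.mpr (by linarith : (0 : ℝ) ≤ 2 * s))]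
        ring

include hlam h1 h2 hg hM hM0 hε hC hg1 in
/-- **THE RESOLVENT PRESERVES `L¹(φ_{λ′} sinh 2t dt)` FOR EVERY `λ > 1`**: `G^I_λ g · φ_{λ′} sinh 2t` is integrable on
`(0, ∞)` for a source of the class with `|g| φ_{λ′} sinh 2s ∈ L¹(0, ∞)`. -/
theorem integrableOn_greenSolI_mul_sph_mul_sinh :
    IntegrableOn (fun t => greenSolI (fun t => sph lam (hyp t)) (sphDecay lam) g t * sph lam' (hyp t)
      * Real.sinh (2 * t)) (Ioi 0) := by
  have hF := integrable_prod_kernel_abs_weighted hlam h1 h2 hg hg1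
  have hH := hF.integral_prod_left
  have hcont : ContinuousOn (fun t => greenSolI (fun t => sph lam (hyp t)) (sphDecay lam) g t * sph lam' (hyp t)
      * Real.sinh (2 * t)) (Ioi 0) :=
    ((continuousOn_greenSolI hlam hg hM hM0 hε hC).mul (continuous_sph_hyp lam').continuousOn).mul
      (Real.continuous_sinh.comp (continuous_const.mul continuous_id)).continuousOn
  refine Integrable.mono' hH (hcont.aestronglyMeasurable measurableSet_Ioi) ?_
  refine (ae_restrict_iff' measurableSet_Ioi).mpr (Eventually.of_forall fun t ht => ?_)
  have ht0 : 0 < t := ht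
  have hsinh : 0 ≤ Real.sinh (2 * t) := Real.sinh_nonneg_iff.mpr (by linarith)
  have hφ : 0 < sph lam' (hyp t) := sph_hyp_pos lam' t
  rw [Real.norm_eq_abs, abs_mul, abs_mul, abs_of_pos hφ, abs_of_nonneg hsinh]
  have e : ∫ s in Ioi 0, Function.uncurry (fun t s => |sphGreenKernel lam t s| * (|g s| * Real.sinh (2 * s))
      * (sph lam' (hyp t) * Real.sinh (2 * t))) (t, s)
      = (∫ s in Ioi 0, |sphGreenKernel lam t s| * (|g s| * Real.sinh (2 * s))) * (sph lam' (hyp t) * Real.sinh (2 * t)) := by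
    rw [← MeasureTheory.integral_mul_const]
    apply setIntegral_congr_fun measurableSet_Ioi
    intro s _
    simp only [Function.uncurry_apply_pair]
  rw [e, mul_assoc]
  exact mul_le_mul_of_nonneg_right (abs_greenSolI_le_integral_abs hlam hg hM hM0 hε hC ht0) (mul_nonneg hφ.le hsinh)

include hlam h1 h2 hg hM hM0 hε hC hg1 in
/-- **THE WEIGHTED `L¹` BOUND OF THE RESOLVENT FOR EVERY `λ > 1`**:
`∫_{(0,∞)} |G^I_λ g| φ_{λ′} sinh 2t dt ≤ (∫_{(0,∞)} |g| φ_{λ′} sinh 2s ds)/(μ − μ′)` for `1 < λ′ < λ` and every source of the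
class with `|g| φ_{λ′} sinh 2s ∈ L¹(0, ∞)` — the operator norm of `(L − μ)⁻¹` on `L¹(φ_{λ′} sinh 2t dt)` is at most
`1/(μ − μ′)`. -/
theorem integral_abs_greenSolI_mul_sph_mul_sinh_le :
    ∫ t in Ioi 0, |greenSolI (fun t => sph lam (hyp t)) (sphDecay lam) g t| * sph lam' (hyp t) * Real.sinh (2 * t)
      ≤ (∫ s in Ioi 0, |g s| * sph lam' (hyp s) * Real.sinh (2 * s)) / (lam * (lam - 2) - lam' * (lam' - 2)) := by
  have hμ : 0 < lam * (lam - 2) - lam' * (lam' - 2) := by nlinarith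
  have hF := integrable_prod_kernel_abs_weighted hlam h1 h2 hg hg1
  have hswap := integral_integral_swap hF
  -- the left-hand side is dominated by the iterated integral
  have hleft : ∫ t in Ioi 0, |greenSolI (fun t => sph lam (hyp t)) (sphDecay lam) g t| * sph lam' (hyp t)
        * Real.sinh (2 * t)
      ≤ ∫ t in Ioi 0, ∫ s in Ioi 0, |sphGreenKernel lam t s| * (|g s| * Real.sinh (2 * s))
        * (sph lam' (hyp t) * Real.sinh (2 * t)) := by
    refine integral_mono_of_nonneg ?_ hF.integral_prod_left ?_
    · exact ae_restrict_of_forall_mem measurableSet_Ioi (fun t ht =>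
        mul_nonneg (mul_nonneg (abs_nonneg _) (sph_hyp_pos lam' t).le)
          (Real.sinh_nonneg_iff.mpr (by linarith [Set.mem_Ioi.mp ht])))
    · refine ae_restrict_of_forall_mem measurableSet_Ioi (fun t ht => ?_)
      have ht0 : 0 < t := ht
      have hsinh : 0 ≤ Real.sinh (2 * t) := Real.sinh_nonneg_iff.mpr (by linarith)
      have hφ : 0 < sph lam' (hyp t) := sph_hyp_pos lam' t
      have e : ∫ s in Ioi 0, |sphGreenKernel lam t s| * (|g s| * Real.sinh (2 * s)) * (sph lam' (hyp t) * Real.sinh (2 * t))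
          = (∫ s in Ioi 0, |sphGreenKernel lam t s| * (|g s| * Real.sinh (2 * s)))
            * (sph lam' (hyp t) * Real.sinh (2 * t)) := MeasureTheory.integral_mul_const _ _
      simp only
      rw [e, mul_assoc]
      exact mul_le_mul_of_nonneg_right (abs_greenSolI_le_integral_abs hlam hg hM hM0 hε hC ht0)
        (mul_nonneg hφ.le hsinh)
  -- the swapped iterated integral is `∫_s |g s| φ_{λ′}(s) sinh 2s/(μ − μ′)`
  have hright : ∫ s in Ioi 0, ∫ t in Ioi 0, |sphGreenKernel lam t s| * (|g s| * Real.sinh (2 * s))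
        * (sph lam' (hyp t) * Real.sinh (2 * t))
      = (∫ s in Ioi 0, |g s| * sph lam' (hyp s) * Real.sinh (2 * s)) / (lam * (lam - 2) - lam' * (lam' - 2)) := by
    rw [← MeasureTheory.integral_div]
    apply setIntegral_congr_fun measurableSet_Ioi
    intro s hs
    have hs0 : 0 < s := hs
    simp only
    have e : ∫ t in Ioi 0, |sphGreenKernel lam t s| * (|g s| * Real.sinh (2 * s)) * (sph lam' (hyp t) * Real.sinh (2 * t))
        = ∫ t in Ioi 0, |sphGreenKernel lam t s * sph lam' (hyp t) * Real.sinh (2 * t)| * (|g s| * Real.sinh (2 * s)) := by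
      apply setIntegral_congr_fun measurableSet_Ioi
      intro t ht
      have ht0 : 0 < t := ht
      simp only
      rw [abs_mul, abs_mul, abs_of_pos (sph_hyp_pos lam' t),
        abs_of_nonneg (Real.sinh_nonneg_iff.mpr (by linarith : (0 : ℝ) ≤ 2 * t))]
      ring
    rw [e, MeasureTheory.integral_mul_const, integral_abs_kernel_mul_sph_fst hlam h1 h2 hs0]
    ring
  calc ∫ t in Ioi 0, |greenSolI (fun t => sph lam (hyp t)) (sphDecay lam) g t| * sph lam' (hyp t) * Real.sinh (2 * t)
      ≤ ∫ t in Ioi 0, ∫ s in Ioi 0, |sphGreenKernel lam t s| * (|g s| * Real.sinh (2 * s))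
          * (sph lam' (hyp t) * Real.sinh (2 * t)) := hleft
    _ = ∫ s in Ioi 0, ∫ t in Ioi 0, |sphGreenKernel lam t s| * (|g s| * Real.sinh (2 * s))
          * (sph lam' (hyp t) * Real.sinh (2 * t)) := hswap
    _ = (∫ s in Ioi 0, |g s| * sph lam' (hyp s) * Real.sinh (2 * s)) / (lam * (lam - 2) - lam' * (lam' - 2)) := hright

end measure

end Summit.Ventures.HodgeRepro2.T5SU11ResolventL1Weighted
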